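import Summits.QuantumFields.BalabanUV.Beta.D1BFx.GradedBubbleTerms

/-!
# `BalabanUV.Beta.D1BFx.ScaleLegByParts` — road «BF-x» for binder row D1, «A3.c ∕ L-X TAILS» part (C3): SUMMATION BY PARTS in the relative
# position `w` for weighted elementary terms (`tsum` over `ℤ⁴`): a (0,k)-term is a (1,k−1)-term under the shifted weight plus a (0,k−1)-term
# under the weight's difference; symmetrically for (k,0)

HONEST DEPENDENCY (page 1, mandatory): continuum YM on T⁴ ⇐ BetaPertH ∧ nine spine estimates (0/9 proved); BetaPertH ⇐ (D1) ∧ (D4) ∧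
CAP+tail; G-an2-4 gates asym, D1 and NE2/3/4.  HONEST FRAMING (cell contract, verbatim): «discharging `BetaPertH` makes Bałaban's UV
stability UNCONDITIONAL — a real constructive-QFT result; it is NOT the continuum limit and NOT the Clay problem.»  THIS MODULE DISCHARGES
NOTHING of the wall: [folklore] `tsum` re-indexing (`Equiv.subRight`) and regrouping (`Summable.tsum_add∕tsum_sub`) over part (A) `GradedBubbleTerms`
(`ETerm.eval`, `fdiffF_iterD`).  Every identity is CONDITIONAL on the summability of its four pieces (supplied at fixed `n` by part (C2)).  Nothing about
Bałaban's kernels is asserted; no `def`, no `Prop` minted, nothing cited, 0 sorry.  0 wall binders; NOT the L-X row, NOT A3.c, NOT (K), NOT D1, NOT `BetaPertH`,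
NOT continuum, NOT Clay.

ABSOLUTE RULE (cell charter, verbatim): «No internally-minted statement may enter as a cited fact. Every hypothesis is either kernel-proved in
this package or a verbatim quotation of a PUBLISHED theorem with page reference. The manuscript(s) under audit are NOT citable for their own
disputed steps — they are the thing under adjudication; programme-internal (2001/route/tribunal) claims are never citable.»

WHY (owner d1-p2-g9 RULING ρ-g9-32 accepting N-d1leaf03g12-1 (β′)): the (0,k)∕(k,0) located-pair terms of the L-X words (all differences on ONE leg) are
not n-uniformly summable from the END's rows; one summation by parts moves a difference to the other leg (weight shifted) at the price of a term with the
weight DIFFERENCED (degree lowered by one) — both admissible for part (C2).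
`Σ'_w Q(w)·c·H₁(x−w)·[H₂(w+y+a) − H₂(w+y)] = Σ'_w Q(w−a)·c·[H₁(x+a−w) − H₁(x−w)]·H₂(w+y) + Σ'_w [Q(w−a) − Q(w)]·c·H₁(x−w)·H₂(w+y)`.
* [folklore] `iterD_nil∕singleton∕cons_const_apply`, **`tsum_byParts`** (abstract), **`tsum_weight_eval_nil_cons`** (`⟨c,x,y,[],a::as⟩ =
  ⟨c,x,y,[a],as⟩` under `Q(·−a)` `+` `⟨c,x,y,[],as⟩` under `Q(·−a) − Q`), **`tsum_weight_eval_cons_nil`** (`⟨c,x,y,a::as,[]⟩ = ⟨c,x,y,as,[a]⟩` under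
  `Q(·+a)` `−` `⟨c,x,y,as,[]⟩` under `Q − Q(·+a)`).
Unit `b2b-balaban-beta-d1-formalise-leaf-03` (gen 12), D1 formalisation swarm; `LEAVES-BFx.md` row «A3.c ∕ L-X TAILS» part (C3).
-/

noncomputable section

namespace Summit.QuantumFields.BalabanUV.Beta.D1BFx.ScaleLegByParts

open Literature.MathematicalPhysics.QuantumFieldTheory.Balaban1983to89.Beta
open DyadicShell (Pt)
open GradedBubbles (Fam fdiffF iterD)
open GradedBubbleTerms (ETerm fdiffF_iterD)

/-! ## §1 Summation by parts in the relative position -/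

section ByParts

variable {Q H₁ H₂ : Pt → ℝ} {c : ℝ} (x y a : Pt)

/-- [folklore] **SUMMATION BY PARTS (abstract, `tsum` over `ℤ⁴`)**: if the four pieces are summable,
`Σ'_w Q(w)·c·H₁(x−w)·[H₂(w+y+a) − H₂(w+y)] = Σ'_w Q(w−a)·c·[H₁(x−w+a) − H₁(x−w)]·H₂(w+y) + Σ'_w [Q(w−a) − Q(w)]·c·H₁(x−w)·H₂(w+y)`
(re-index the first sum by `w ↦ w − a`, then regroup). -/
theorem tsum_byParts
    (hS1 : Summable fun w : Pt => Q w * (c * (H₁ (x - w) * H₂ (w + (y + a)))))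
    (hS2 : Summable fun w : Pt => Q w * (c * (H₁ (x - w) * H₂ (w + y))))
    (hS3 : Summable fun w : Pt => Q (w - a) * (c * ((H₁ (x + a - w) - H₁ (x - w)) * H₂ (w + y))))
    (hS4 : Summable fun w : Pt => (Q (w - a) - Q w) * (c * (H₁ (x - w) * H₂ (w + y)))) :
    ∑' w : Pt, Q w * (c * (H₁ (x - w) * (H₂ (w + (y + a)) - H₂ (w + y)))) =
      (∑' w : Pt, Q (w - a) * (c * ((H₁ (x + a - w) - H₁ (x - w)) * H₂ (w + y))))
        + ∑' w : Pt, (Q (w - a) - Q w) * (c * (H₁ (x - w) * H₂ (w + y))) := by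
  -- the first piece re-indexed: `w ↦ w − a`
  have hre : ∑' w : Pt, Q w * (c * (H₁ (x - w) * H₂ (w + (y + a)))) = ∑' w : Pt, Q (w - a) * (c * (H₁ (x + a - w) * H₂ (w + y))) := by
    rw [← (Equiv.subRight a).tsum_eq (fun w : Pt => Q w * (c * (H₁ (x - w) * H₂ (w + (y + a)))))]
    refine tsum_congr fun w => ?_
    simp only [Equiv.subRight_apply]
    rw [show x - (w - a) = x + a - w by abel, show w - a + (y + a) = w + y by abel]
  have hS1' : Summable fun w : Pt => Q (w - a) * (c * (H₁ (x + a - w) * H₂ (w + y))) := by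
    have h := (Equiv.subRight a).summable_iff.mpr hS1
    refine h.congr fun w => ?_
    simp only [Function.comp_apply, Equiv.subRight_apply]
    rw [show x - (w - a) = x + a - w by abel, show w - a + (y + a) = w + y by abel]
  have lhs : ∑' w : Pt, Q w * (c * (H₁ (x - w) * (H₂ (w + (y + a)) - H₂ (w + y)))) =
      (∑' w : Pt, Q w * (c * (H₁ (x - w) * H₂ (w + (y + a))))) - ∑' w : Pt, Q w * (c * (H₁ (x - w) * H₂ (w + y))) := by
    rw [← hS1.tsum_sub hS2]
    exact tsum_congr fun w => by ring
  have rhs : (∑' w : Pt, Q (w - a) * (c * ((H₁ (x + a - w) - H₁ (x - w)) * H₂ (w + y))))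
        + ∑' w : Pt, (Q (w - a) - Q w) * (c * (H₁ (x - w) * H₂ (w + y))) =
      (∑' w : Pt, Q (w - a) * (c * (H₁ (x + a - w) * H₂ (w + y)))) - ∑' w : Pt, Q w * (c * (H₁ (x - w) * H₂ (w + y))) := by
    rw [← hS3.tsum_add hS4, ← hS1'.tsum_sub hS2]
    exact tsum_congr fun w => by ring
  rw [lhs, rhs, hre]

end ByParts

section ByPartsTerms

variable (g : Pt → ℝ)

/-- [folklore] The value of a no-step family. -/
theorem iterD_nil_const_apply (u : Pt) : iterD [] (fun (_ : ℕ) (_ : ℕ) => g) 0 0 u = g u := rfl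

/-- [folklore] The value of a one-step difference family. -/
theorem iterD_singleton_const_apply (a u : Pt) :
    iterD [a] (fun (_ : ℕ) (_ : ℕ) => g) 0 0 u = g (u + a) - g u := rfl

/-- [folklore] The value of a cons-step family: a difference of the tail family. -/
theorem iterD_cons_const_apply (a : Pt) (as : List Pt) (u : Pt) :
    iterD (a :: as) (fun (_ : ℕ) (_ : ℕ) => g) 0 0 u = iterD as (fun (_ : ℕ) (_ : ℕ) => g) 0 0 (u + a) - iterD as (fun (_ : ℕ) (_ : ℕ) => g) 0 0 u := by
  rw [← fdiffF_iterD]; rfl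

variable {g}

/-- [folklore] **BY PARTS FOR A (0, k)-TERM** `t = ⟨c, x, y, [], a :: as⟩`: with the weight moved, it is the (1, k−1)-term `⟨c, x, y, [a], as⟩` under
`Q(· − a)` plus the (0, k−1)-term `⟨c, x, y, [], as⟩` under `Q(· − a) − Q` — given summability of the four pieces. -/
theorem tsum_weight_eval_nil_cons {Q : Pt → ℝ} {c : ℝ} {x y a : Pt} {as : List Pt}
    (hS1 : Summable fun w : Pt => Q w * (ETerm.eval (fun _ _ => g) (fun _ _ => g) ⟨c, x, y + a, [], as⟩ 0 0 w))
    (hS2 : Summable fun w : Pt => Q w * (ETerm.eval (fun _ _ => g) (fun _ _ => g) ⟨c, x, y, [], as⟩ 0 0 w))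
    (hS3 : Summable fun w : Pt => Q (w - a) * (ETerm.eval (fun _ _ => g) (fun _ _ => g) ⟨c, x, y, [a], as⟩ 0 0 w))
    (hS4 : Summable fun w : Pt => (Q (w - a) - Q w) * (ETerm.eval (fun _ _ => g) (fun _ _ => g) ⟨c, x, y, [], as⟩ 0 0 w)) :
    ∑' w : Pt, Q w * (ETerm.eval (fun _ _ => g) (fun _ _ => g) ⟨c, x, y, [], a :: as⟩ 0 0 w) =
      (∑' w : Pt, Q (w - a) * (ETerm.eval (fun _ _ => g) (fun _ _ => g) ⟨c, x, y, [a], as⟩ 0 0 w))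
        + ∑' w : Pt, (Q (w - a) - Q w) * (ETerm.eval (fun _ _ => g) (fun _ _ => g) ⟨c, x, y, [], as⟩ 0 0 w) := by
  have h := tsum_byParts (Q := Q) (H₁ := g) (H₂ := fun u => iterD as (fun (_ : ℕ) (_ : ℕ) => g) 0 0 u) (c := c) x y a
    (by refine hS1.congr fun w => ?_; simp only [ETerm.eval, iterD_nil_const_apply])
    (by refine hS2.congr fun w => ?_; simp only [ETerm.eval, iterD_nil_const_apply])
    (by refine hS3.congr fun w => ?_; simp only [ETerm.eval, iterD_singleton_const_apply]; rw [show x - w + a = x + a - w by abel])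
    (by refine hS4.congr fun w => ?_; simp only [ETerm.eval, iterD_nil_const_apply])
  have e0 : ∀ w : Pt, Q w * (ETerm.eval (fun _ _ => g) (fun _ _ => g) ⟨c, x, y, [], a :: as⟩ 0 0 w) =
      Q w * (c * (g (x - w) * (iterD as (fun (_ : ℕ) (_ : ℕ) => g) 0 0 (w + (y + a)) - iterD as (fun (_ : ℕ) (_ : ℕ) => g) 0 0 (w + y)))) := by
    intro w
    simp only [ETerm.eval, iterD_nil_const_apply, iterD_cons_const_apply]
    rw [show w + y + a = w + (y + a) by abel]
  have e1 : ∀ w : Pt, Q (w - a) * (ETerm.eval (fun _ _ => g) (fun _ _ => g) ⟨c, x, y, [a], as⟩ 0 0 w) =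
      Q (w - a) * (c * ((g (x + a - w) - g (x - w)) * iterD as (fun (_ : ℕ) (_ : ℕ) => g) 0 0 (w + y))) := by
    intro w
    simp only [ETerm.eval, iterD_singleton_const_apply]
    rw [show x - w + a = x + a - w by abel]
  have e2 : ∀ w : Pt, (Q (w - a) - Q w) * (ETerm.eval (fun _ _ => g) (fun _ _ => g) ⟨c, x, y, [], as⟩ 0 0 w) =
      (Q (w - a) - Q w) * (c * (g (x - w) * iterD as (fun (_ : ℕ) (_ : ℕ) => g) 0 0 (w + y))) := by
    intro w; simp only [ETerm.eval, iterD_nil_const_apply]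
  simp only [e0, e1, e2]
  exact h

/-- [folklore] **BY PARTS FOR A (k, 0)-TERM** `t = ⟨c, x, y, a :: as, []⟩`: it is the (k−1, 1)-term `⟨c, x, y, as, [a]⟩` under `Q(· + a)` MINUS the
(k−1, 0)-term `⟨c, x, y, as, []⟩` under `Q − Q(· + a)` — given summability of the four pieces. -/
theorem tsum_weight_eval_cons_nil {Q : Pt → ℝ} {c : ℝ} {x y a : Pt} {as : List Pt}
    (hS1 : Summable fun w : Pt => Q (w + a) * (ETerm.eval (fun _ _ => g) (fun _ _ => g) ⟨c, x, y + a, as, []⟩ 0 0 w))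
    (hS2 : Summable fun w : Pt => Q (w + a) * (ETerm.eval (fun _ _ => g) (fun _ _ => g) ⟨c, x, y, as, []⟩ 0 0 w))
    (hS3 : Summable fun w : Pt => Q w * (ETerm.eval (fun _ _ => g) (fun _ _ => g) ⟨c, x, y, a :: as, []⟩ 0 0 w))
    (hS4 : Summable fun w : Pt => (Q w - Q (w + a)) * (ETerm.eval (fun _ _ => g) (fun _ _ => g) ⟨c, x, y, as, []⟩ 0 0 w)) :
    ∑' w : Pt, Q w * (ETerm.eval (fun _ _ => g) (fun _ _ => g) ⟨c, x, y, a :: as, []⟩ 0 0 w) =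
      (∑' w : Pt, Q (w + a) * (ETerm.eval (fun _ _ => g) (fun _ _ => g) ⟨c, x, y, as, [a]⟩ 0 0 w))
        - ∑' w : Pt, (Q w - Q (w + a)) * (ETerm.eval (fun _ _ => g) (fun _ _ => g) ⟨c, x, y, as, []⟩ 0 0 w) := by
  -- the abstract identity with `Q' := Q(· + a)`, `H₁ := ∂^{as}g`, `H₂ := g`
  set H : Pt → ℝ := fun u => iterD as (fun (_ : ℕ) (_ : ℕ) => g) 0 0 u with hH
  have hQ : ∀ w : Pt, Q (w + a - a) = Q w := fun w => by rw [add_sub_cancel_right]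
  have h := tsum_byParts (Q := fun w => Q (w + a)) (H₁ := H) (H₂ := g) (c := c) x y a
    (by refine hS1.congr fun w => ?_; simp only [ETerm.eval, iterD_nil_const_apply, hH])
    (by refine hS2.congr fun w => ?_; simp only [ETerm.eval, iterD_nil_const_apply, hH])
    (by
      refine hS3.congr fun w => ?_
      simp only [ETerm.eval, iterD_nil_const_apply, hH, iterD_cons_const_apply, sub_add_cancel]
      rw [show x - w + a = x + a - w by abel])
    (by
      refine hS4.congr fun w => ?_
      simp only [ETerm.eval, iterD_nil_const_apply, hH, sub_add_cancel])
  simp only [sub_add_cancel] at h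
  -- read the identity: its LHS is the `(as, [a])`-piece, its RHS's first sum is the `(a :: as, [])`-term
  have e1 : ∀ w : Pt, Q (w + a) * (ETerm.eval (fun _ _ => g) (fun _ _ => g) ⟨c, x, y, as, [a]⟩ 0 0 w) =
      Q (w + a) * (c * (H (x - w) * (g (w + (y + a)) - g (w + y)))) := by
    intro w
    simp only [ETerm.eval, hH, iterD_singleton_const_apply]
    rw [show w + y + a = w + (y + a) by abel]
  have e3 : ∀ w : Pt, Q w * (ETerm.eval (fun _ _ => g) (fun _ _ => g) ⟨c, x, y, a :: as, []⟩ 0 0 w) =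
      Q w * (c * ((H (x + a - w) - H (x - w)) * g (w + y))) := by
    intro w
    simp only [ETerm.eval, hH, iterD_nil_const_apply, iterD_cons_const_apply]
    rw [show x - w + a = x + a - w by abel]
  have e4 : ∀ w : Pt, (Q w - Q (w + a)) * (ETerm.eval (fun _ _ => g) (fun _ _ => g) ⟨c, x, y, as, []⟩ 0 0 w) =
      (Q w - Q (w + a)) * (c * (H (x - w) * g (w + y))) := by
    intro w; simp only [ETerm.eval, iterD_nil_const_apply, hH]
  simp only [e1, e3, e4]
  rw [h]
  ring

end ByPartsTerms

end Summit.QuantumFields.BalabanUV.Beta.D1BFx.ScaleLegByParts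

end
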